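import Mathlib
import Summits.Parity.GeneralizedHardyLittlewood.Theorems.FordMaynardSieveConst01651SieveConst01651GreedyBlocks

/-!
# Route `FordMaynardSieveConst01651`, target `SieveConst01651` (stmt-Parity-19185), line `sieve_decomposition`:
# helpers towards `stub_typeIIRegion` — Ford–Maynard's canonical decomposition (7.12) `(eq:diprimes)` of an
# integer into blocks, integer form

`…GreedyBlocks` proves existence and uniqueness of the greedy segmentation of a LIST.  Here the list is the
decreasing list of prime factors `d.primeFactorsList.reverse` of `d ≥ 1` and the blocks are read as integers
`d₁, …, d_s` (their products): `d = d₁ ⋯ d_s` with every `d_j > 1`, the primes of `d_{j'}` at most the primes of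
`d_j` for `j < j'` (the printed `P⁻(d_i) ≥ P⁺(d_{i+1})`), `d_j ≤ L · P⁻(d_j)` for all `j` and `d_j > L` for `j < s`
— and this tuple EXISTS and is UNIQUE (`blockTuple_existsUnique`), which is what the re-indexing
`∑_d f(d) α_{d,m} = ∑_s ∑_{(d₁,…,d_s)} f_{s,1}(d₁) ⋯ f_{s,s}(d_s) α_{d₁⋯d_s,m}` of Lemma 7.17 rests on.

* `primeFactorsList_prod_reverse`, `mem_primeFactorsList_prod_iff`, `minFac_prod_eq_getLast` — a decreasing list
  of primes is the reversed factor list of its product; its last entry is `P⁻`.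
* `blockTuple_exists`, `blockTuple_unique`, `blockTuple_existsUnique`.

Def-free. Nothing here proves anything about the Parity summit; helpers for the Type-II region stub of one leaf.
-/

namespace Summit.Parity.GeneralizedHardyLittlewood.FordMaynardSieveConst01651SieveConst01651

/-! ### Lists of primes in decreasing order -/

/-- The prime factors of the product of a list of primes are its members. [folklore] -/
theorem mem_primeFactorsList_prod_iff {b : List ℕ} (hb : ∀ a ∈ b, a.Prime) {p : ℕ} :
    p ∈ (b.prod).primeFactorsList ↔ p ∈ b :=
  ((Nat.primeFactorsList_unique rfl hb).mem_iff).symm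

/-- A decreasing list of primes is the reversed prime-factor list of its product. [folklore] -/
theorem primeFactorsList_prod_reverse {b : List ℕ} (hb : ∀ a ∈ b, a.Prime) (hs : b.SortedGE) :
    (b.prod).primeFactorsList.reverse = b := by
  have hperm : (b.prod).primeFactorsList.reverse.Perm b :=
    (List.reverse_perm _).trans (Nat.primeFactorsList_unique rfl hb).symm
  exact hperm.eq_of_sortedGE (List.sortedGE_reverse.mpr (Nat.primeFactorsList_sorted _)) hs

/-- The reversed prime-factor list of `e ≠ 0` has product `e`. [folklore] -/
theorem prod_reverse_primeFactorsList {e : ℕ} (he : e ≠ 0) : (e.primeFactorsList.reverse).prod = e := by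
  rw [List.prod_reverse, Nat.prod_primeFactorsList he]

/-- A nonempty list of primes has product `> 1`. [folklore] -/
theorem one_lt_prod_of_primes {b : List ℕ} (hne : b ≠ []) (hb : ∀ a ∈ b, a.Prime) : 1 < b.prod := by
  obtain ⟨a, b', rfl⟩ := List.exists_cons_of_ne_nil hne
  rw [List.prod_cons]
  have ha : 2 ≤ a := (hb a List.mem_cons_self).two_le
  have hb' : 1 ≤ b'.prod :=
    one_le_prod_of_forall_one_le fun c hc => (hb c (List.mem_cons_of_mem a hc)).one_lt.le
  calc 1 < 2 * 1 := by norm_num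
    _ ≤ a * b'.prod := Nat.mul_le_mul ha hb'

/-- In a decreasing list of primes the last entry is the least prime factor of the product (`P⁻`). [folklore] -/
theorem minFac_prod_eq_getLast {b : List ℕ} (hne : b ≠ []) (hb : ∀ a ∈ b, a.Prime) (hs : b.SortedGE) :
    (b.prod).minFac = b.getLast hne := by
  have hlast_mem : b.getLast hne ∈ b := List.getLast_mem hne
  have hlast_prime : (b.getLast hne).Prime := hb _ hlast_mem
  refine le_antisymm (Nat.minFac_le_of_dvd hlast_prime.two_le (List.dvd_prod hlast_mem)) ?_
  -- `minFac` is a prime factor, hence a member of `b`, hence `≥` the last entry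
  have hprod1 : b.prod ≠ 1 := (one_lt_prod_of_primes hne hb).ne'
  have hmem : (b.prod).minFac ∈ b := by
    rw [← mem_primeFactorsList_prod_iff hb, Nat.mem_primeFactorsList (one_lt_prod_of_primes hne hb).ne_bot]
    exact ⟨Nat.minFac_prime hprod1, Nat.minFac_dvd _⟩
  -- every member is `≥` the last one
  have hsplit := List.dropLast_append_getLast hne
  have hpw : (b.dropLast ++ [b.getLast hne]).Pairwise (· ≥ ·) := by
    rw [hsplit]; exact List.sortedGE_iff_pairwise.mp hs
  rw [List.pairwise_append] at hpw
  have hmem' : (b.prod).minFac ∈ b.dropLast ++ [b.getLast hne] := by rw [hsplit]; exact hmem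
  rcases List.mem_append.mp hmem' with h | h
  · exact hpw.2.2 _ h _ (List.mem_singleton.mpr rfl)
  · exact (List.mem_singleton.mp h).symm.le

/-! ### The block tuple of an integer -/

/-- **Existence of the block tuple** of `d ≥ 1` at threshold `L ≥ 1`: `d = d₁ ⋯ d_s` with every `d_j > 1`,
primes decreasing across blocks, `d_j ≤ L · P⁻(d_j)` and `d_j > L` for `j < s`. (For `d = 1` the tuple is empty.)
[cite: FordMaynard2024PrimeSieves, (7.12)] -/
theorem blockTuple_exists {L : ℝ} (hL : 1 ≤ L) {d : ℕ} (hd : d ≠ 0) :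
    ∃ D : List ℕ, D.prod = d ∧ (∀ e ∈ D, 1 < e) ∧
      D.Pairwise (fun e e' => ∀ p ∈ e'.primeFactorsList, ∀ q ∈ e.primeFactorsList, p ≤ q) ∧
      (∀ e ∈ D, (e : ℝ) ≤ L * (e.minFac : ℝ)) ∧ (∀ e ∈ D.dropLast, L < (e : ℝ)) := by
  set l := d.primeFactorsList.reverse with hl
  have hlprime : ∀ a ∈ l, a.Prime := fun a ha =>
    Nat.prime_of_mem_primeFactorsList (List.mem_reverse.mp ha)
  have hlsorted : l.SortedGE := List.sortedGE_reverse.mpr (Nat.primeFactorsList_sorted d)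
  obtain ⟨B, hBflat, hBne, hBdrop, hBlast⟩ :=
    greedyBlocks_exists hL l fun a ha => (hlprime a ha).one_lt.le
  -- every block is a decreasing list of primes
  have hbprime : ∀ b ∈ B, ∀ a ∈ b, a.Prime := fun b hb a ha =>
    hlprime a (hBflat ▸ List.mem_flatten.mpr ⟨b, hb, ha⟩)
  have hpwflat : l.Pairwise (· ≥ ·) := List.sortedGE_iff_pairwise.mp hlsorted
  rw [← hBflat, List.pairwise_flatten] at hpwflat
  have hbsorted : ∀ b ∈ B, b.SortedGE := fun b hb => List.sortedGE_iff_pairwise.mpr (hpwflat.1 b hb)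
  refine ⟨B.map List.prod, ?_, ?_, ?_, ?_, ?_⟩
  · rw [← List.prod_flatten, hBflat, hl, List.prod_reverse, Nat.prod_primeFactorsList hd]
  · intro e he
    obtain ⟨b, hb, rfl⟩ := List.mem_map.mp he
    exact one_lt_prod_of_primes (hBne b hb) (hbprime b hb)
  · rw [List.pairwise_map]
    refine hpwflat.2.imp_of_mem ?_
    intro b₁ b₂ hb₁ hb₂ h p hp q hq
    rw [mem_primeFactorsList_prod_iff (hbprime _ hb₂)] at hp
    rw [mem_primeFactorsList_prod_iff (hbprime _ hb₁)] at hq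
    exact h q hq p hp
  · intro e he
    obtain ⟨b, hb, rfl⟩ := List.mem_map.mp he
    rw [minFac_prod_eq_getLast (hBne b hb) (hbprime b hb) (hbsorted b hb)]
    exact greedyBlocks_prod_le (hBne b hb) (hBdrop b hb)
  · intro e he
    rw [← List.map_dropLast] at he
    obtain ⟨b, hb, rfl⟩ := List.mem_map.mp he
    exact hBlast b hb

/-- **Uniqueness of the block tuple.** [cite: FordMaynard2024PrimeSieves, (7.12) ("can be decomposed uniquely")] -/
theorem blockTuple_unique {L : ℝ} {d : ℕ} {D₁ D₂ : List ℕ}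
    (hp₁ : D₁.prod = d) (hone₁ : ∀ e ∈ D₁, 1 < e)
    (hpw₁ : D₁.Pairwise (fun e e' => ∀ p ∈ e'.primeFactorsList, ∀ q ∈ e.primeFactorsList, p ≤ q))
    (hmin₁ : ∀ e ∈ D₁, (e : ℝ) ≤ L * (e.minFac : ℝ)) (hlast₁ : ∀ e ∈ D₁.dropLast, L < (e : ℝ))
    (hp₂ : D₂.prod = d) (hone₂ : ∀ e ∈ D₂, 1 < e)
    (hpw₂ : D₂.Pairwise (fun e e' => ∀ p ∈ e'.primeFactorsList, ∀ q ∈ e.primeFactorsList, p ≤ q))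
    (hmin₂ : ∀ e ∈ D₂, (e : ℝ) ≤ L * (e.minFac : ℝ)) (hlast₂ : ∀ e ∈ D₂.dropLast, L < (e : ℝ)) :
    D₁ = D₂ := by
  set l := d.primeFactorsList.reverse with hl
  have hlsorted : l.SortedGE := List.sortedGE_reverse.mpr (Nat.primeFactorsList_sorted d)
  -- the segmentation attached to a block tuple
  have key : ∀ D : List ℕ, D.prod = d → (∀ e ∈ D, 1 < e) →
      D.Pairwise (fun e e' => ∀ p ∈ e'.primeFactorsList, ∀ q ∈ e.primeFactorsList, p ≤ q) →
      (∀ e ∈ D, (e : ℝ) ≤ L * (e.minFac : ℝ)) → (∀ e ∈ D.dropLast, L < (e : ℝ)) →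
      (D.map fun e => e.primeFactorsList.reverse).flatten = l ∧
      (∀ b ∈ D.map (fun e => e.primeFactorsList.reverse), b ≠ []) ∧
      (∀ b ∈ D.map (fun e => e.primeFactorsList.reverse), (((b.dropLast).prod : ℕ) : ℝ) ≤ L) ∧
      (∀ b ∈ (D.map fun e => e.primeFactorsList.reverse).dropLast, L < ((b.prod : ℕ) : ℝ)) := by
    intro D hp hone hpw hmin hlast
    set B := D.map (fun e => e.primeFactorsList.reverse) with hB
    have hne0 : ∀ e ∈ D, e ≠ 0 := fun e he => (hone e he).ne_bot
    have hblock : ∀ e : ℕ, e ≠ 0 → (∀ a ∈ e.primeFactorsList.reverse, a.Prime) ∧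
        (e.primeFactorsList.reverse).SortedGE ∧ (e.primeFactorsList.reverse).prod = e := fun e he =>
      ⟨fun a ha => Nat.prime_of_mem_primeFactorsList (List.mem_reverse.mp ha),
        List.sortedGE_reverse.mpr (Nat.primeFactorsList_sorted e), prod_reverse_primeFactorsList he⟩
    -- the flattening is a decreasing list of primes with product `d`, hence `= l`
    have hflat_prime : ∀ a ∈ B.flatten, a.Prime := by
      intro a ha
      obtain ⟨b, hb, hab⟩ := List.mem_flatten.mp ha
      obtain ⟨e, he, rfl⟩ := List.mem_map.mp hb
      exact (hblock e (hne0 e he)).1 a hab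
    have hflat_prod : B.flatten.prod = d := by
      rw [List.prod_flatten, hB, List.map_map, ← hp]
      congr 1
      refine List.map_congr_left ?_ |>.trans (List.map_id _)
      intro e he
      exact (hblock e (hne0 e he)).2.2
    have hflat_sorted : B.flatten.SortedGE := by
      rw [List.sortedGE_iff_pairwise, List.pairwise_flatten]
      constructor
      · intro b hb
        obtain ⟨e, he, rfl⟩ := List.mem_map.mp hb
        exact List.sortedGE_iff_pairwise.mp (hblock e (hne0 e he)).2.1
      · rw [hB, List.pairwise_map]
        refine hpw.imp_of_mem ?_
        intro e₁ e₂ he₁ he₂ h x hx y hy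
        exact h y (List.mem_reverse.mp hy) x (List.mem_reverse.mp hx)
    have hflat : B.flatten = l := by
      have hperm : B.flatten.Perm l :=
        (Nat.primeFactorsList_unique hflat_prod hflat_prime).trans (List.reverse_perm _).symm
      exact hperm.eq_of_sortedGE hflat_sorted hlsorted
    refine ⟨hflat, ?_, ?_, ?_⟩
    · intro b hb
      obtain ⟨e, he, rfl⟩ := List.mem_map.mp hb
      rw [Ne, List.reverse_eq_nil_iff, Nat.primeFactorsList_eq_nil]
      push Not
      exact ⟨hne0 e he, (hone e he).ne'⟩
    · intro b hb
      obtain ⟨e, he, rfl⟩ := List.mem_map.mp hb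
      obtain ⟨hbp, hbs, hbprod⟩ := hblock e (hne0 e he)
      have hbne : e.primeFactorsList.reverse ≠ [] := by
        rw [Ne, List.reverse_eq_nil_iff, Nat.primeFactorsList_eq_nil]
        push Not
        exact ⟨hne0 e he, (hone e he).ne'⟩
      -- `e = (dropLast).prod * P⁻(e)` and `e ≤ L P⁻(e)`
      set k := (e.primeFactorsList.reverse.dropLast).prod with hk
      have hsplit : k * e.minFac = e := by
        conv_rhs => rw [← hbprod, ← List.dropLast_append_getLast hbne]
        rw [List.prod_append, List.prod_singleton, ← minFac_prod_eq_getLast hbne hbp hbs, hbprod]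
      have hmf : (0 : ℝ) < (e.minFac : ℝ) := by exact_mod_cast Nat.minFac_pos e
      have hkR : (k : ℝ) * (e.minFac : ℝ) = (e : ℝ) := by exact_mod_cast hsplit
      have h1 : (k : ℝ) * (e.minFac : ℝ) ≤ L * (e.minFac : ℝ) := by rw [hkR]; exact hmin e he
      exact le_of_mul_le_mul_right h1 hmf
    · intro b hb
      rw [hB, ← List.map_dropLast] at hb
      obtain ⟨e, he, rfl⟩ := List.mem_map.mp hb
      rw [prod_reverse_primeFactorsList (hne0 e (List.dropLast_subset _ he))]
      exact hlast e he
  obtain ⟨hf₁, hne₁, hdrop₁, hl₁⟩ := key D₁ hp₁ hone₁ hpw₁ hmin₁ hlast₁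
  obtain ⟨hf₂, hne₂, hdrop₂, hl₂⟩ := key D₂ hp₂ hone₂ hpw₂ hmin₂ hlast₂
  have hpos : ∀ a ∈ (D₁.map fun e => e.primeFactorsList.reverse).flatten, 1 ≤ a := by
    rw [hf₁]
    intro a ha
    exact (Nat.prime_of_mem_primeFactorsList (List.mem_reverse.mp ha)).one_lt.le
  have hB := greedyBlocks_unique _ _ hpos (hf₁.trans hf₂.symm) hne₁ hdrop₁ hl₁ hne₂ hdrop₂ hl₂
  -- read the blocks back as integers
  have hread : ∀ D : List ℕ, (∀ e ∈ D, 1 < e) →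
      (D.map fun e => e.primeFactorsList.reverse).map List.prod = D := by
    intro D hone
    rw [List.map_map]
    refine List.map_congr_left ?_ |>.trans (List.map_id _)
    intro e he
    exact prod_reverse_primeFactorsList (hone e he).ne_bot
  rw [← hread D₁ hone₁, ← hread D₂ hone₂, hB]

/-- **The block tuple of `d ≥ 1` exists and is unique** (Ford–Maynard's canonical decomposition (7.12), integer
form). [cite: FordMaynard2024PrimeSieves, (7.12)] -/
theorem blockTuple_existsUnique {L : ℝ} (hL : 1 ≤ L) {d : ℕ} (hd : d ≠ 0) :
    ∃! D : List ℕ, D.prod = d ∧ (∀ e ∈ D, 1 < e) ∧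
      D.Pairwise (fun e e' => ∀ p ∈ e'.primeFactorsList, ∀ q ∈ e.primeFactorsList, p ≤ q) ∧
      (∀ e ∈ D, (e : ℝ) ≤ L * (e.minFac : ℝ)) ∧ (∀ e ∈ D.dropLast, L < (e : ℝ)) := by
  obtain ⟨D, hD⟩ := blockTuple_exists hL hd
  refine ⟨D, hD, fun D' hD' => ?_⟩
  exact blockTuple_unique hD'.1 hD'.2.1 hD'.2.2.1 hD'.2.2.2.1 hD'.2.2.2.2
    hD.1 hD.2.1 hD.2.2.1 hD.2.2.2.1 hD.2.2.2.2

/-! ### Consequences used in Lemma 7.17 -/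

/-- **A composite block is `≤ L²`.** If `e > 1` is not prime and `e ≤ L · P⁻(e)` then, since `P⁻(e)² ≤ e`,
`e ≤ L²` — the printed "if `d_j` is not prime then `P⁻(d_j) ≤ L` and hence `P⁺(d_j) ≤ d_j ≤ L²`".
[cite: FordMaynard2024PrimeSieves, Lemma 7.17 (proof)] -/
theorem block_le_sq_of_not_prime {L : ℝ} (hL : 0 ≤ L) {e : ℕ} (he : 1 < e) (hp : ¬ e.Prime)
    (hmin : (e : ℝ) ≤ L * (e.minFac : ℝ)) : (e : ℝ) ≤ L ^ 2 := by
  have hsq : ((e.minFac : ℕ) : ℝ) ^ 2 ≤ (e : ℝ) := by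
    exact_mod_cast Nat.minFac_sq_le_self (by omega) hp
  have hm0 : (0 : ℝ) < (e.minFac : ℝ) := by exact_mod_cast Nat.minFac_pos e
  -- `minFac e ≤ L`
  have hmL : (e.minFac : ℝ) ≤ L := by
    have : (e.minFac : ℝ) * (e.minFac : ℝ) ≤ L * (e.minFac : ℝ) := by nlinarith
    exact le_of_mul_le_mul_right this hm0
  calc (e : ℝ) ≤ L * (e.minFac : ℝ) := hmin
    _ ≤ L * L := mul_le_mul_of_nonneg_left hmL hL
    _ = L ^ 2 := (sq L).symm

/-- **Smoothness is read on the blocks.** For a block tuple `D` of `d` (product `d`, blocks `> 1` with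
`d_j ≤ L · P⁻(d_j)`) and a bound `y ≥ L²`: every prime factor of `d` is `≤ y` iff every block is `≤ y` — the
printed "the condition `P⁺(d) ≤ (dm)^σ` is equivalent to the collection of conditions `d_j ≤ (d₁⋯d_s m)^σ`".
[cite: FordMaynard2024PrimeSieves, Lemma 7.17 (proof)] -/
theorem blockTuple_primeFactors_le_iff {L y : ℝ} (hL : 0 ≤ L) (hy : L ^ 2 ≤ y) {d : ℕ} {D : List ℕ}
    (hp : D.prod = d) (hone : ∀ e ∈ D, 1 < e) (hmin : ∀ e ∈ D, (e : ℝ) ≤ L * (e.minFac : ℝ)) :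
    (∀ p ∈ d.primeFactorsList, (p : ℝ) ≤ y) ↔ (∀ e ∈ D, (e : ℝ) ≤ y) := by
  have hd0 : d ≠ 0 := by
    rw [← hp]
    exact Nat.pos_iff_ne_zero.mp (one_le_prod_of_forall_one_le fun e he => (hone e he).le)
  constructor
  · intro h e he
    by_cases hpr : e.Prime
    · refine h e ((Nat.mem_primeFactorsList hd0).mpr ⟨hpr, ?_⟩)
      rw [← hp]; exact List.dvd_prod he
    · exact (block_le_sq_of_not_prime hL (hone e he) hpr (hmin e he)).trans hy
  · intro h p hpmem
    obtain ⟨hpr, hpd⟩ := (Nat.mem_primeFactorsList hd0).mp hpmem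
    rw [← hp] at hpd
    obtain ⟨e, he, hpe⟩ := (Prime.dvd_prod_iff hpr.prime).mp hpd
    have hep : (p : ℝ) ≤ (e : ℝ) := by
      exact_mod_cast Nat.le_of_dvd (by linarith [hone e he]) hpe
    exact hep.trans (h e he)

/-- **Few blocks**, integer form: `L^{s-1} ≤ d` for a block tuple with `s` blocks (all-but-last `> L`, all `≥ 1`,
`L ≥ 0`). [cite: FordMaynard2024PrimeSieves, Lemma 7.17 (proof, "`s ≤ 1 + 3/σ`")] -/
theorem blockTuple_pow_length_le {L : ℝ} (hL : 0 ≤ L) {D : List ℕ} (hone : ∀ e ∈ D, 1 ≤ e)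
    (hlast : ∀ e ∈ D.dropLast, L < (e : ℝ)) : L ^ (D.length - 1) ≤ ((D.prod : ℕ) : ℝ) := by
  by_cases hD : D = []
  · subst hD; simp
  · have hsplit := List.dropLast_append_getLast hD
    have hprod : D.prod = D.dropLast.prod * D.getLast hD := by
      conv_lhs => rw [← hsplit]
      rw [List.prod_append, List.prod_singleton]
    have h1 : L ^ (D.length - 1) ≤ ((D.dropLast.prod : ℕ) : ℝ) := by
      rw [← List.length_dropLast]
      exact pow_length_le_prod hL hlast
    have h2 : (1 : ℝ) ≤ ((D.getLast hD : ℕ) : ℝ) := by exact_mod_cast hone _ (List.getLast_mem hD)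
    rw [hprod, Nat.cast_mul]
    calc L ^ (D.length - 1) ≤ ((D.dropLast.prod : ℕ) : ℝ) * 1 := by rw [mul_one]; exact h1
      _ ≤ ((D.dropLast.prod : ℕ) : ℝ) * ((D.getLast hD : ℕ) : ℝ) :=
          mul_le_mul_of_nonneg_left h2 (Nat.cast_nonneg _)

/-- **Multiplicative functions split over the blocks of a squarefree number** (the case (b) of Definition 7.15 used
for `μ`, Lemma 7.16 (ii)): if `f` is multiplicative and `D.prod` is squarefree then `f(∏ D) = ∏ f(d_j)` — the blocks
are automatically pairwise coprime. [cite: FordMaynard2024PrimeSieves, Lemma 7.16 (ii)] -/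
theorem map_list_prod_of_squarefree {R : Type*} [CommMonoidWithZero R] {f : ArithmeticFunction R}
    (hf : f.IsMultiplicative) : ∀ D : List ℕ, Squarefree D.prod → f D.prod = (D.map f).prod := by
  intro D
  induction D with
  | nil => intro _; simp [hf.map_one]
  | cons e D ih =>
    intro hsq
    rw [List.prod_cons] at hsq ⊢
    obtain ⟨hcop, _, hsqD⟩ := Nat.squarefree_mul_iff.mp hsq
    rw [hf.map_mul_of_coprime hcop, ih hsqD, List.map_cons, List.prod_cons]

/-! ### The block tuple as a function; re-indexing a sum over `d` by block tuples -/

/-- **A block-tuple FUNCTION** `T` (chosen once for all `d ≥ 1`; `T 0` is irrelevant): `T d` is the block tuple of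
`d` and every block tuple of `d` equals `T d`. (The tree keeps (7.12) def-free; inside a proof, `obtain ⟨T, hT⟩`.)
[cite: FordMaynard2024PrimeSieves, (7.12)] -/
theorem exists_blockTuple_fn {L : ℝ} (hL : 1 ≤ L) :
    ∃ T : ℕ → List ℕ, ∀ d : ℕ, d ≠ 0 →
      ((T d).prod = d ∧ (∀ e ∈ T d, 1 < e) ∧
        (T d).Pairwise (fun e e' => ∀ p ∈ e'.primeFactorsList, ∀ q ∈ e.primeFactorsList, p ≤ q) ∧
        (∀ e ∈ T d, (e : ℝ) ≤ L * (e.minFac : ℝ)) ∧ (∀ e ∈ (T d).dropLast, L < (e : ℝ))) ∧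
      ∀ D : List ℕ, D.prod = d → (∀ e ∈ D, 1 < e) →
        D.Pairwise (fun e e' => ∀ p ∈ e'.primeFactorsList, ∀ q ∈ e.primeFactorsList, p ≤ q) →
        (∀ e ∈ D, (e : ℝ) ≤ L * (e.minFac : ℝ)) → (∀ e ∈ D.dropLast, L < (e : ℝ)) → D = T d := by
  classical
  refine ⟨fun d => if h : d ≠ 0 then Classical.choose (blockTuple_exists hL h) else [], fun d hd => ?_⟩
  have hspec := Classical.choose_spec (blockTuple_exists hL hd)
  simp only [dif_pos hd]
  refine ⟨hspec, fun D hp hone hpw hmin hlast => ?_⟩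
  exact blockTuple_unique hp hone hpw hmin hlast hspec.1 hspec.2.1 hspec.2.2.1 hspec.2.2.2.1 hspec.2.2.2.2

/-- **Re-indexing by block tuples**: if `T` returns tuples with product `d` on `S`, then `T` is injective on `S` and
`∑_{d ∈ S} F(d) = ∑_{D ∈ T(S)} F(∏ D)` — the first step of Lemma 7.17,
`∑_d f(d) α_{d,m} = ∑_s ∑_{(d₁,…,d_s)} f(d₁ ⋯ d_s) α_{d₁⋯d_s,m}`. [cite: FordMaynard2024PrimeSieves, Lemma 7.17 (proof)] -/
theorem sum_eq_sum_image_blockTuple {M : Type*} [AddCommMonoid M] {S : Finset ℕ} {T : ℕ → List ℕ}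
    (hT : ∀ d ∈ S, (T d).prod = d) (F : ℕ → M) :
    ∑ d ∈ S, F d = ∑ D ∈ S.image T, F D.prod := by
  classical
  have hinj : Set.InjOn T S := by
    intro d₁ h₁ d₂ h₂ heq
    rw [← hT d₁ h₁, ← hT d₂ h₂, heq]
  rw [Finset.sum_image hinj]
  exact Finset.sum_congr rfl fun d hd => by rw [hT d hd]

/-- **Smoothness is read on the blocks, strict form** (the tree's `smoothPart` collects the primes `p < y`):
for `y > L²`, every prime factor of `d` is `< y` iff every block is `< y`.
[cite: FordMaynard2024PrimeSieves, Lemma 7.17 (proof)] -/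
theorem blockTuple_primeFactors_lt_iff {L y : ℝ} (hL : 0 ≤ L) (hy : L ^ 2 < y) {d : ℕ} {D : List ℕ}
    (hp : D.prod = d) (hone : ∀ e ∈ D, 1 < e) (hmin : ∀ e ∈ D, (e : ℝ) ≤ L * (e.minFac : ℝ)) :
    (∀ p ∈ d.primeFactorsList, (p : ℝ) < y) ↔ (∀ e ∈ D, (e : ℝ) < y) := by
  have hd0 : d ≠ 0 := by
    rw [← hp]
    exact Nat.pos_iff_ne_zero.mp (one_le_prod_of_forall_one_le fun e he => (hone e he).le)
  constructor
  · intro h e he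
    by_cases hpr : e.Prime
    · refine h e ((Nat.mem_primeFactorsList hd0).mpr ⟨hpr, ?_⟩)
      rw [← hp]; exact List.dvd_prod he
    · exact (block_le_sq_of_not_prime hL (hone e he) hpr (hmin e he)).trans_lt hy
  · intro h p hpmem
    obtain ⟨hpr, hpd⟩ := (Nat.mem_primeFactorsList hd0).mp hpmem
    rw [← hp] at hpd
    obtain ⟨e, he, hpe⟩ := (Prime.dvd_prod_iff hpr.prime).mp hpd
    have hep : (p : ℝ) ≤ (e : ℝ) := by
      exact_mod_cast Nat.le_of_dvd (by linarith [hone e he]) hpe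
    exact hep.trans_lt (h e he)

/-- **Every block is a Type-II variable at `θ = 0`.** If all prime factors of `d` are `< y` (smoothness) and
`y > L²`, then every block `e` of `d` satisfies `1 < e < y`: composite blocks are `≤ L² < y`, prime blocks are
prime factors. (At `P = (1/2, 0, ν)` with `y = n^ν ≤ x^ν`: each block of the smooth parts `u`, `v` lies in the
Type-II range `(1, x^ν]`.) [cite: FordMaynard2024PrimeSieves, Lemma 7.17 and proof of Proposition 7.22] -/
theorem blockTuple_mem_range {L y : ℝ} (hL : 0 ≤ L) (hy : L ^ 2 < y) {d : ℕ} {D : List ℕ}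
    (hp : D.prod = d) (hone : ∀ e ∈ D, 1 < e) (hmin : ∀ e ∈ D, (e : ℝ) ≤ L * (e.minFac : ℝ))
    (hsmooth : ∀ p ∈ d.primeFactorsList, (p : ℝ) < y) : ∀ e ∈ D, 1 < e ∧ (e : ℝ) < y :=
  fun e he => ⟨hone e he, (blockTuple_primeFactors_lt_iff hL hy hp hone hmin).mp hsmooth e he⟩

/-- **Blocks of a squarefree number are squarefree and pairwise coprime** (so `μ(u) = ∏ μ(u_j) = (-1)^{Σ ω(u_j)}`
and divisors of `u` factor uniquely along the blocks). [cite: FordMaynard2024PrimeSieves, Definition 7.15 (b) /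
Lemma 7.16 (ii)] -/
theorem squarefree_blocks_of_squarefree :
    ∀ D : List ℕ, Squarefree D.prod → (∀ e ∈ D, Squarefree e) ∧ D.Pairwise Nat.Coprime := by
  intro D
  induction D with
  | nil => intro _; simp
  | cons e D ih =>
    intro hsq
    rw [List.prod_cons] at hsq
    obtain ⟨hcop, hsqe, hsqD⟩ := Nat.squarefree_mul_iff.mp hsq
    obtain ⟨ih1, ih2⟩ := ih hsqD
    refine ⟨?_, List.pairwise_cons.mpr ⟨fun e' he' => ?_, ih2⟩⟩
    · intro e' he'
      rcases List.mem_cons.mp he' with rfl | he'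
      · exact hsqe
      · exact ih1 e' he'
    · exact Nat.Coprime.coprime_dvd_right (List.dvd_prod he') hcop

end Summit.Parity.GeneralizedHardyLittlewood.FordMaynardSieveConst01651SieveConst01651
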